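import Literature.Analysis.FluidPDE.KNSSWindowLipschitz
import Literature.Analysis.FluidPDE.LeiZhang2011StreamLimit
import HarnessLib

/-!
# Lei–Zhang 2011, Theorem 1.4: the uniform space–time Lipschitz bound on a window from the
# `BMO` stream function (the parasitic part cannot oscillate)

Analysis/FluidPDE **proofs file** (theorems only: no definitions, no named facts, no `sorry`) on
the discharge path of the named fact
`Literature.Analysis.FluidPDE.LeiZhang2011_regularity_bmoStream` (Z. Lei, Q. S. Zhang,
J. Funct. Anal. 261 (2011) = arXiv:1011.5066, **Theorem 1.4**). The printed proof extracts from
the rescalings `v^{(k)}` a locally uniformly convergent subsequence with a one-line reference: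
"`{v^{(k)}}` (up to a subsequence) converges to a bounded ancient weak solution `u(x, t)` … (for
details, see [KNSS])" (p. 12). In the tree the KNSS detail is
`KNSS2009_regularity_boundedWeak_window.lipschitz_of_cylRadius_bound` (`KNSSWindowLipschitz`): a
uniform space–time Lipschitz bound, up to the final time, for bounded weak solutions on a unit
window, from §4 of KNSS (the proved window fact `KNSS2009_regularity_boundedWeak_window`:
`u = U + b(t)` a.e. with `U` smooth, `‖∇U‖ ≤ C`, `U` Lipschitz in time). There the decay (6.4)
`|x'| |u| ≤ C` is what stops the parasitic part `b(t)` from oscillating. Under the hypotheses of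
Lei–Zhang's Theorem 1.4 this role is played by the `BMO` stream function:

* `norm_sub_le_of_bmoStream_of_forall_norm_sub_le` — **the parasitic part cannot move**: if
  `u(t) = U(t) + b(t)`, `u(s) = U(s) + b(s)` everywhere with `‖U(t, ·) − U(s, ·)‖_∞ ≤ ℓ`, and both
  slices have differentiable stream functions with `BMO` seminorm `≤ K`, then
  `‖b(t) − b(s)‖ ≤ ℓ` (test `u(t) − u(s)` against the plateaux `φ_R` in the direction
  `d = b(t) − b(s)`: `‖d‖² ∫φ_R ≤ 2 A K ‖d‖ R² + ℓ ‖d‖ ∫φ_R` by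
  `exists_abs_integral_ballCutoff_mul_inner_le` (`LeiZhang2011StreamLimit`), `∫φ_R ≥ 8R³|B(0,1)|`,
  `R → ∞`);
* `KNSS2009_regularity_boundedWeak_window.lipschitz_of_bmoStream` — the uniform Lipschitz bound
  on `[1/2, 1) × ℝ³` for bounded weak solutions on `ℝ³ × (0, 1)`, continuous on the open slab,
  `‖u‖ ≤ M`, with a `HasBMOStreamFunctionOn (Ioo 0 1)` stream function; the constant depends on
  `M` only (steps (a), (c), (d) verbatim as in `KNSSWindowLipschitz`, step (b) by the lemma
  above).

## Mathlib / tree search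

Reused: `KNSS2009_regularity_boundedWeak_window`, `norm_iteratedFDeriv_zero_sub`
(`KNSSRegularityWindow`, `KNSSWindowLipschitz`), `exists_abs_integral_ballCutoff_mul_inner_le`
(`LeiZhang2011StreamLimit`), `ballCutoff_eq_one`, `ballCutoff_nonneg` (`BallCutoff`),
`HasBMOStreamFunctionOn` (`LeiZhang2011`); Mathlib `Convex.norm_image_sub_le_of_norm_fderiv_le`,
`Measure.eq_of_ae_eq`, `Measure.dense_of_ae`, `Measure.addHaar_closedBall`.

## References

* Z. Lei, Q. S. Zhang, *A Liouville theorem for the axially-symmetric Navier–Stokes equations*,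
  J. Funct. Anal. 261 (2011) 2323–2345 = arXiv:1011.5066: Thm. 1.4, proof §4 (p. 12).
  [LeiZhang2011]
* G. Koch, N. Nadirashvili, G. Seregin, V. Šverák, Acta Math. 203 (2009) = arXiv:0709.3599,
  §4 (4.10)–(4.11), Lemma 6.1, proof of Thm. 6.1 (p. 12). [KochNadirashviliSereginSverak2009]
-/

noncomputable section

open MeasureTheory Set Function Filter Topology TopologicalSpace Metric
open scoped InnerProductSpace RealInnerProductSpace NNReal ENNReal

namespace Literature.Analysis.FluidPDE

open Literature.Analysis.FunctionSpaces

/-- **The parasitic part of a field with a `BMO` stream function cannot move.** Let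
`u(t, ·) = U(t, ·) + b(t)` and `u(s, ·) = U(s, ·) + b(s)` everywhere, with continuous slices
`u(t, ·)`, `u(s, ·)` having differentiable stream functions `curl B_τ = u(τ, ·)` a.e.,
`‖B_τ‖_{BMO} ≤ K`, and `‖U(t, x) − U(s, x)‖ ≤ ℓ` for all `x`. Then `‖b(t) − b(s)‖ ≤ ℓ`: testing
`u(t) − u(s) = (U(t) − U(s)) + (b(t) − b(s))` against the plateaux `φ_R` in the direction
`d = b(t) − b(s)` gives `‖d‖² ∫φ_R ≤ 2 A K ‖d‖ R² + ℓ ‖d‖ ∫φ_R` by the pairing estimate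
`exists_abs_integral_ballCutoff_mul_inner_le`, and `∫ φ_R ≥ |B̄(0, 2R)| = 8 R³ |B(0,1)|`; let
`R → ∞`. This replaces the use of the decay `|x'| |u| ≤ C` in
`KNSS2009_regularity_boundedWeak_window.lipschitz_of_cylRadius_bound` (KNSS 2009, proof of
Thm. 6.1, last paragraph). [cite: LeiZhang2011, Thm. 1.4, proof §4 (arXiv pp. 12–13)] -/
theorem norm_sub_le_of_bmoStream_of_forall_norm_sub_le
    {ut us Ut Us Bt Bs : EuclideanSpace ℝ (Fin 3) → EuclideanSpace ℝ (Fin 3)}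
    {bt bs : EuclideanSpace ℝ (Fin 3)} {K : ℝ≥0} {ℓ : ℝ} (hℓ : 0 ≤ ℓ)
    (hut : ∀ x, ut x = Ut x + bt) (hus : ∀ x, us x = Us x + bs)
    (hct : Continuous ut) (hcs : Continuous us)
    (hBt : Differentiable ℝ Bt) (hcurlt : curl Bt =ᵐ[volume] ut) (hbmot : eBMOSeminormVec Bt ≤ K)
    (hBs : Differentiable ℝ Bs) (hcurls : curl Bs =ᵐ[volume] us) (hbmos : eBMOSeminormVec Bs ≤ K)
    (hU : ∀ x, ‖Ut x - Us x‖ ≤ ℓ) :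
    ‖bt - bs‖ ≤ ℓ := by
  obtain ⟨A, hA, hest⟩ := exists_abs_integral_ballCutoff_mul_inner_le
  set d : EuclideanSpace ℝ (Fin 3) := bt - bs with hd
  set V : ℝ := volume.real (ball (0 : EuclideanSpace ℝ (Fin 3)) 1) with hV
  have hVpos : 0 < V :=
    ENNReal.toReal_pos (measure_ball_pos volume _ one_pos).ne' measure_ball_lt_top.ne
  by_cases hd0 : d = 0
  · rw [hd0, norm_zero]; exact hℓ
  have hdpos : 0 < ‖d‖ := norm_pos_iff.2 hd0
  -- the estimate at scale `R`
  have hR : ∀ R : ℝ, 0 < R → ‖d‖ ≤ A * K / (4 * V) / R + ℓ := by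
    intro R hR
    set φ : EuclideanSpace ℝ (Fin 3) → ℝ := ballCutoff 0 R with hφ
    have hφc : Continuous φ := (contDiff_ballCutoff 0 R (n := 0)).continuous
    have hφs : HasCompactSupport φ := hasCompactSupport_ballCutoff hR
    have hφi : Integrable φ := hφc.integrable_of_hasCompactSupport hφs
    have hφ0 : ∀ x, 0 ≤ φ x := fun x => ballCutoff_nonneg 0 R x
    set I : ℝ := ∫ x, φ x with hI
    -- `8 R³ V ≤ ∫ φ`
    have hIlow : 8 * R ^ 3 * V ≤ I := by
      have h2R : 0 ≤ 2 * R := by linarith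
      have hvol :
          volume.real (closedBall (0 : EuclideanSpace ℝ (Fin 3)) (2 * R)) = 8 * R ^ 3 * V := by
        simp only [hV, Measure.real]
        rw [Measure.addHaar_closedBall volume _ h2R, finrank_euclideanSpace_fin, ENNReal.toReal_mul,
          ENNReal.toReal_ofReal (pow_nonneg h2R 3)]
        ring
      have hind : ∫ x, (closedBall (0 : EuclideanSpace ℝ (Fin 3)) (2 * R)).indicator
          (fun _ => (1 : ℝ)) x =
            volume.real (closedBall (0 : EuclideanSpace ℝ (Fin 3)) (2 * R)) := by
        rw [integral_indicator measurableSet_closedBall, setIntegral_const, smul_eq_mul, mul_one]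
      rw [← hvol, ← hind]
      refine integral_mono ((integrableOn_const measure_closedBall_lt_top.ne).integrable_indicator
        measurableSet_closedBall) hφi fun x => ?_
      by_cases hx : x ∈ closedBall (0 : EuclideanSpace ℝ (Fin 3)) (2 * R)
      · rw [indicator_of_mem hx, hφ, ballCutoff_eq_one hR (by simpa using hx)]
      · rw [indicator_of_notMem hx]; exact hφ0 x
    have hIpos : 0 < I := lt_of_lt_of_le (by positivity) hIlow
    -- integrability of the pairings
    have hint : ∀ (w : EuclideanSpace ℝ (Fin 3) → EuclideanSpace ℝ (Fin 3)), Continuous w →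
        Integrable (fun x => φ x * ⟪w x, d⟫) := fun w hw =>
      (hφc.mul (hw.inner continuous_const)).integrable_of_hasCompactSupport hφs.mul_right
    -- the identity `∫ φ ⟪u t − u s, d⟫ = ∫ φ ⟪U t − U s, d⟫ + ‖d‖² ∫ φ`
    have hUc : Continuous fun x => Ut x - Us x := by
      have h1 : (fun x => Ut x - Us x) = fun x => (ut x - us x) - d := by
        funext x; rw [hut x, hus x, hd]; abel
      rw [h1]; exact (hct.sub hcs).sub continuous_const
    have hsplit : (∫ x, φ x * ⟪ut x, d⟫) - ∫ x, φ x * ⟪us x, d⟫ =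
        (∫ x, φ x * ⟪Ut x - Us x, d⟫) + ‖d‖ ^ 2 * I := by
      rw [← integral_sub (hint ut hct) (hint us hcs), hI, ← integral_const_mul,
        ← integral_add (hint _ hUc) (hφi.const_mul _)]
      refine integral_congr_ae (Eventually.of_forall fun x => ?_)
      have : ut x - us x = (Ut x - Us x) + d := by rw [hut x, hus x, hd]; abel
      dsimp only
      rw [← mul_sub, ← inner_sub_left, this, inner_add_left, real_inner_self_eq_norm_sq]
      ring
    -- the three bounds
    have h1 : |∫ x, φ x * ⟪ut x, d⟫| ≤ A * K * ‖d‖ * R ^ 2 :=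
      hest Bt ut hBt hcurlt hct.locallyIntegrable K hbmot 0 R hR d
    have h2 : |∫ x, φ x * ⟪us x, d⟫| ≤ A * K * ‖d‖ * R ^ 2 :=
      hest Bs us hBs hcurls hcs.locallyIntegrable K hbmos 0 R hR d
    have h3 : |∫ x, φ x * ⟪Ut x - Us x, d⟫| ≤ ℓ * ‖d‖ * I := by
      rw [hI, ← integral_const_mul, ← Real.norm_eq_abs]
      refine norm_integral_le_of_norm_le (hφi.const_mul _) (Eventually.of_forall fun x => ?_)
      rw [norm_mul, Real.norm_eq_abs, abs_of_nonneg (hφ0 x)]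
      calc φ x * ‖⟪Ut x - Us x, d⟫‖ ≤ φ x * (ℓ * ‖d‖) := by
            refine mul_le_mul_of_nonneg_left ?_ (hφ0 x)
            exact (norm_inner_le_norm _ _).trans (mul_le_mul_of_nonneg_right (hU x) (norm_nonneg _))
        _ = ℓ * ‖d‖ * φ x := by ring
    -- combine: `‖d‖² I ≤ 2 A K ‖d‖ R² + ℓ ‖d‖ I`
    have hkey : ‖d‖ ^ 2 * I ≤ 2 * (A * K * ‖d‖ * R ^ 2) + ℓ * ‖d‖ * I := by
      have e := hsplit
      have := abs_sub (∫ x, φ x * ⟪ut x, d⟫) (∫ x, φ x * ⟪us x, d⟫)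
      nlinarith [le_abs_self ((∫ x, φ x * ⟪ut x, d⟫) - ∫ x, φ x * ⟪us x, d⟫),
        neg_abs_le (∫ x, φ x * ⟪Ut x - Us x, d⟫), h1, h2, h3, this]
    -- divide by `‖d‖ I`
    have hkey' : ‖d‖ * I ≤ 2 * (A * K * R ^ 2) + ℓ * I := by
      have : ‖d‖ * (‖d‖ * I) ≤ ‖d‖ * (2 * (A * K * R ^ 2) + ℓ * I) := by nlinarith [hkey]
      exact le_of_mul_le_mul_left this hdpos
    have hdiv : ‖d‖ ≤ 2 * (A * K * R ^ 2) / I + ℓ := by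
      rw [div_add' _ _ _ hIpos.ne', le_div_iff₀ hIpos]; linarith
    calc ‖d‖ ≤ 2 * (A * K * R ^ 2) / I + ℓ := hdiv
      _ ≤ 2 * (A * K * R ^ 2) / (8 * R ^ 3 * V) + ℓ := by
          gcongr
      _ = A * K / (4 * V) / R + ℓ := by field_simp; ring
  -- let `R → ∞`
  have hlim : Tendsto (fun R : ℝ => A * K / (4 * V) / R + ℓ) atTop (𝓝 (0 + ℓ)) :=
    (tendsto_const_nhds.div_atTop tendsto_id).add tendsto_const_nhds
  rw [zero_add] at hlim
  exact ge_of_tendsto hlim ((eventually_gt_atTop 0).mono fun R hR0 => hR R hR0)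

/-- **Uniform space–time Lipschitz bound on a unit window for bounded weak solutions with a
`BMO` stream function**, from KNSS 2009, §4 on a window (the Lei–Zhang analogue of
`KNSS2009_regularity_boundedWeak_window.lipschitz_of_cylRadius_bound`, with the decay (6.4)
replaced by the stream hypothesis of Theorem 1.4). For every `M` there is `K ≥ 0` such that:
for every bounded weak solution `u` of Navier–Stokes (`ν = 1`) on `ℝ³ × (0, 1)`, continuous on the
open slab, with `‖u‖ ≤ M` there and a stream function with `BMO` slices on `(0, 1)`
(`HasBMOStreamFunctionOn`, any bound), `‖u(t, x) − u(s, y)‖ ≤ K (|t − s| + ‖x − y‖)` for all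
`s, t ∈ [1/2, 1)`, `x, y`. The constant depends on `M` only, not on the `BMO` bound. Proof: the
window fact gives `u = U + b(t)` a.e. with `U` smooth, `‖∇U‖ ≤ C`, `U` Lipschitz in time; at good
times `u(t, ·) = U(t, ·) + b(t)` everywhere (continuity); the parasitic part obeys
`‖b(t) − b(s)‖ ≤ L |t − s|` by `norm_sub_le_of_bmoStream_of_forall_norm_sub_le`; the mean value
inequality and density of good times finish as in the KNSS case. This is the uniform regularity,
up to the final time, of the rescaled sequence in the proof of Lei–Zhang's Theorem 1.4 ("`v^{(k)}`
(up to a subsequence) converges to a bounded ancient weak solution", arXiv:1011.5066 p. 12,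
"for details, see [KNSS]"). [cite: LeiZhang2011, Thm. 1.4, proof §4 (arXiv p. 12)] -/
theorem KNSS2009_regularity_boundedWeak_window.lipschitz_of_bmoStream
    (hW : KNSS2009_regularity_boundedWeak_window) (M : ℝ) :
    ∃ K : ℝ, 0 ≤ K ∧ ∀ ⦃u : ℝ → (EuclideanSpace ℝ (Fin 3)) → (EuclideanSpace ℝ (Fin 3))⦄,
      IsBoundedWeakNSSolutionOn (Ioo 0 1) isOpen_Ioo 1 u →
      ContinuousOn (uncurry u) (Ioo (0 : ℝ) 1 ×ˢ univ) →
      (∀ t ∈ Ioo (0 : ℝ) 1, ∀ x, ‖u t x‖ ≤ M) →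
      (∃ (B : ℝ → EuclideanSpace ℝ (Fin 3) → EuclideanSpace ℝ (Fin 3)) (Kb : ℝ≥0),
        HasBMOStreamFunctionOn (Ioo 0 1) u B Kb) →
      ∀ s ∈ Ico (1 / 2 : ℝ) 1, ∀ t ∈ Ico (1 / 2 : ℝ) 1, ∀ x y : (EuclideanSpace ℝ (Fin 3)),
        ‖u t x - u s y‖ ≤ K * (|t - s| + ‖x - y‖) := by
  obtain ⟨Cf, L, N, hmain⟩ := hW M 1 one_pos
  set C₁ : ℝ := |Cf 1 (1 / 4)| with hC₁
  set L₀ : ℝ := |L 0 (1 / 4)| with hL₀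
  set K : ℝ := C₁ + 2 * L₀ with hK
  have hC₁0 : 0 ≤ C₁ := abs_nonneg _
  have hL₀0 : 0 ≤ L₀ := abs_nonneg _
  refine ⟨K, by positivity, ?_⟩
  rintro u hu hcont hM ⟨B, Kb, hB⟩
  obtain ⟨U, b, -, -, -, hae, hsmooth, -, hD, hL, -⟩ := hmain hu hM
  have hδ : (0 : ℝ) < 1 / 4 := by norm_num
  -- slices of `u` are continuous
  have hslice : ∀ t ∈ Ioo (0 : ℝ) 1, Continuous (u t) := fun t ht =>
    hcont.comp_continuous (Continuous.prodMk_right t) fun x => ⟨ht, mem_univ x⟩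
  -- (a) good times: `u t = U t + b t` everywhere
  set Gd : Set ℝ := {t | t ∈ Ioo (0 : ℝ) 1 → u t = fun x => U t x + b t} with hGd
  have hgood : ∀ᵐ t ∂(volume : Measure ℝ), t ∈ Gd := by
    have h1 := (ae_restrict_iff' (measurableSet_Ioo (a := (0 : ℝ)) (b := 1))).1 hae
    filter_upwards [h1] with t ht ht'
    have hcU : Continuous fun x => U t x + b t :=
      (hsmooth t ht').continuous.add continuous_const
    exact Measure.eq_of_ae_eq (ht ht') (hslice t ht') hcU
  have hdense : Dense Gd := Measure.dense_of_ae hgood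
  -- (b)–(c) the estimate at good times of `(1/4, 1)`
  have hest : ∀ s t : ℝ, s ∈ Ioo (1 / 4 : ℝ) 1 → t ∈ Ioo (1 / 4 : ℝ) 1 → s ∈ Gd → t ∈ Gd →
      ∀ x y : (EuclideanSpace ℝ (Fin 3)), ‖u t x - u s y‖ ≤ K * (|t - s| + ‖x - y‖) := by
    intro s t hs ht hsG htG x y
    have hs' : s ∈ Ioo (0 : ℝ) 1 := ⟨by linarith [hs.1], hs.2⟩
    have ht' : t ∈ Ioo (0 : ℝ) 1 := ⟨by linarith [ht.1], ht.2⟩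
    have hus : ∀ z, u s z = U s z + b s := fun z => congrFun (hsG hs') z
    have hut : ∀ z, u t z = U t z + b t := fun z => congrFun (htG ht') z
    -- time-Lipschitz bound for `U` at order zero
    have hUt : ∀ z, ‖U t z - U s z‖ ≤ L₀ * |t - s| := fun z => by
      have h := hL (1 / 4) hδ 0 s hs t ht z
      rw [norm_iteratedFDeriv_zero_sub] at h
      exact h.trans (mul_le_mul_of_nonneg_right (le_abs_self _) (abs_nonneg _))
    -- (b) the parasitic part: `‖b t - b s‖ ≤ L₀ |t - s|`, by the `BMO` stream function
    have hb : ‖b t - b s‖ ≤ L₀ * |t - s| := by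
      obtain ⟨hdt, hct, hbt⟩ := hB t ht'
      obtain ⟨hds, hcs, hbs⟩ := hB s hs'
      exact norm_sub_le_of_bmoStream_of_forall_norm_sub_le (by positivity) hut hus (hslice t ht')
        (hslice s hs') hdt hct hbt hds hcs hbs hUt
    -- (c) the smooth part in space: mean value inequality
    have hUx : ‖U t x - U t y‖ ≤ C₁ * ‖x - y‖ := by
      have hdiff : ∀ z ∈ (univ : Set (EuclideanSpace ℝ (Fin 3))), DifferentiableAt ℝ (U t) z :=
        fun z _ => ((hsmooth t ht').differentiable (by simp)) z
      have hbound : ∀ z ∈ (univ : Set (EuclideanSpace ℝ (Fin 3))), ‖fderiv ℝ (U t) z‖ ≤ C₁ :=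
        fun z _ => by
          rw [← norm_iteratedFDeriv_one]
          exact (hD (1 / 4) hδ 1 t ht z).trans (le_abs_self _)
      exact Convex.norm_image_sub_le_of_norm_fderiv_le hdiff hbound convex_univ (mem_univ y)
        (mem_univ x)
    -- assemble
    have heq : u t x - u s y = (U t x - U t y) + (U t y - U s y) + (b t - b s) := by
      rw [hut x, hus y]; abel
    have hpos : 0 ≤ C₁ * |t - s| + 2 * L₀ * ‖x - y‖ := by positivity
    calc ‖u t x - u s y‖ = ‖(U t x - U t y) + (U t y - U s y) + (b t - b s)‖ := by rw [heq]
      _ ≤ ‖U t x - U t y‖ + ‖U t y - U s y‖ + ‖b t - b s‖ :=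
          (norm_add_le _ _).trans (add_le_add (norm_add_le _ _) le_rfl)
      _ ≤ C₁ * ‖x - y‖ + L₀ * |t - s| + L₀ * |t - s| := add_le_add (add_le_add hUx (hUt y)) hb
      _ ≤ K * (|t - s| + ‖x - y‖) := by rw [hK]; nlinarith
  -- (d) density of good times and continuity of `u`
  intro s hs t ht x y
  have hO : IsOpen (Ioo (1 / 4 : ℝ) 1) := isOpen_Ioo
  have hsub := hdense.open_subset_closure_inter hO
  have hsO : s ∈ Ioo (1 / 4 : ℝ) 1 := ⟨by linarith [hs.1], hs.2⟩
  have htO : t ∈ Ioo (1 / 4 : ℝ) 1 := ⟨by linarith [ht.1], ht.2⟩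
  obtain ⟨sq, hsq, hsql⟩ := mem_closure_iff_seq_limit.1 (hsub hsO)
  obtain ⟨tq, htq, htql⟩ := mem_closure_iff_seq_limit.1 (hsub htO)
  have hn : ∀ n, ‖u (tq n) x - u (sq n) y‖ ≤ K * (|tq n - sq n| + ‖x - y‖) := fun n =>
    hest (sq n) (tq n) (hsq n).1 (htq n).1 (hsq n).2 (htq n).2 x y
  have hopen : IsOpen (Ioo (0 : ℝ) 1 ×ˢ (univ : Set (EuclideanSpace ℝ (Fin 3)))) :=
    isOpen_Ioo.prod isOpen_univ
  have hct : Tendsto (fun n => u (tq n) x) atTop (𝓝 (u t x)) := by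
    have h1 : ContinuousAt (uncurry u) (t, x) :=
      hcont.continuousAt (hopen.mem_nhds ⟨⟨by linarith [ht.1], ht.2⟩, mem_univ x⟩)
    exact h1.tendsto.comp (htql.prodMk_nhds tendsto_const_nhds)
  have hcs : Tendsto (fun n => u (sq n) y) atTop (𝓝 (u s y)) := by
    have h1 : ContinuousAt (uncurry u) (s, y) :=
      hcont.continuousAt (hopen.mem_nhds ⟨⟨by linarith [hs.1], hs.2⟩, mem_univ y⟩)
    exact h1.tendsto.comp (hsql.prodMk_nhds tendsto_const_nhds)
  refine le_of_tendsto_of_tendsto' (hct.sub hcs).norm ?_ hn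
  exact (((continuous_abs.tendsto _).comp (htql.sub hsql)).add tendsto_const_nhds).const_mul K

end Literature.Analysis.FluidPDE
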